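import Literature.NumberTheory.Sieve.FriedlanderIwaniecPrimesDispersion
import Mathlib.Analysis.Fourier.AddCircle
import Mathlib.Analysis.PSeries
import HarnessLib

/-!
# Friedlander–Iwaniec, *The polynomial `X² + Y⁴` captures its primes*, §16 (16.26)–(16.27): the Fourier series of the angle mollifier `q(α)`

We formalise the two displays of [FI, §16, p. 63 of arXiv:math/9811185] about the "angle mollifier"
`q(α)` — the `2π`-periodic `C²` cutoff attached to `β_z` in (5.13), "supported on `φ < α ≤ φ + 2πθ`
such that `q^{(j)} ≪ θ^{-j}`, `j = 0, 1, 2`" (the text before (5.13), p. 19; in the tree this is the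
structure `FISectorCutoff ϑ θ φ q` of `FriedlanderIwaniecPrimesDispersion`):

> "To this end we expand the "angle mollifier" `q(α)` into its Fourier series
> `q(α) = Σ_ℓ q̂(ℓ) e^{iℓα}`. By the properties of `q(α)` recorded just before (5.13) it follows that
> the Fourier coefficients are bounded by (16.26) `q̂(ℓ) ≪ θ (1 + θ²ℓ²)⁻¹`. Thus we can truncate the
> Fourier series with a small error term (16.27) `q(α) = Σ_{|ℓ| ≤ L} q̂(ℓ) e^{iℓα} + O(θ⁻¹L⁻¹)`."

Both are proved here with explicit constants, for any `2π`-periodic `C²` function `q` with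
`|q| ≤ 1`, `|q''| ≤ θ⁻²` supported on the arcs `φ < α - 2πk ≤ φ + 2πθ` (`0 < θ ≤ 1`):

* `hasSum_fourier_of_sector` — (16.26): `q(α) = Σ_ℓ q̂(ℓ) e^{iℓα}` for **every** `α`, absolutely
  convergent, with `|q̂(ℓ)| ≤ θ` (support of measure `2πθ`) and `|q̂(ℓ)| ≤ θ⁻¹ℓ⁻²` for `ℓ ≠ 0`
  (two integrations by parts, then the support again); `le_sector_coeff_bound` turns the pair of
  bounds into the printed shape `|q̂(ℓ)| ≤ 2θ(1 + θ²ℓ²)⁻¹`.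
* `norm_sub_sum_Icc_le_of_coeff_bound` — (16.27): for coefficients with `|c(ℓ)| ≤ θ⁻¹ℓ⁻²`
  (`ℓ ≠ 0`) summing to `a`, `|a - Σ_{|ℓ| ≤ L} c(ℓ) e^{iℓα}| ≤ 2θ⁻¹L⁻¹` (`L ≥ 1`; the tail
  `Σ_{|ℓ| > L} ℓ⁻² ≤ 2/L`, Mathlib's `sum_Ioc_inv_sq_le_sub`).
* `FISectorCutoff.fourier_truncation` — both statements for the tree's `FISectorCutoff ϑ θ φ q`.

The template is `FriedlanderIwaniecPrimesAngularFourier.hasSum_fourier_of_periodic` (the `C³`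
version over the window `(-π, π]`, used for (17.17)/§23); here the window is `(φ, φ + 2π]`, so that
the support is the single interval `(φ, φ + 2πθ]`, and only two derivatives are used, the missing
power of `ℓ` being replaced by the gain `θ` from the measure of the support — exactly the trade-off
behind the printed `θ(1 + θ²ℓ²)⁻¹`. No new definitions and no named facts are introduced.
-/

noncomputable section

open Real Complex MeasureTheory
open scoped Topology

namespace Literature.NumberTheory.Sieve.FriedlanderIwaniecPrimes

/-! ### Fourier coefficients over the period window `(φ, φ + 2π]` -/

section Window

variable {φ : ℝ}

/-- The period window `(φ, φ + 2π]`. [folklore] -/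
private theorem hwin (φ : ℝ) : φ < φ + 2 * π := lt_add_of_pos_right φ Real.two_pi_pos

/-- `‖fourier n x‖ = 1`. [folklore] -/
private theorem norm_fourier_apply' {T : ℝ} (n : ℤ) (x : AddCircle T) : ‖fourier n x‖ = 1 := by
  rw [fourier_apply]; exact Circle.norm_coe _

/-- One integration by parts over the window: `f̂(n) = f̂'(n)/(in)` for `f(φ + 2π) = f(φ)`, `n ≠ 0`.
[folklore] -/
private theorem fourierCoeffOn_window_of_hasDerivAt {f f' : ℝ → ℂ} {n : ℤ} (hn : n ≠ 0)
    (hf : ∀ x, HasDerivAt f (f' x) x) (hf' : Continuous f') (hper : f (φ + 2 * π) = f φ) :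
    fourierCoeffOn (hwin φ) f n = (1 / (I * n)) * fourierCoeffOn (hwin φ) f' n := by
  rw [fourierCoeffOn_of_hasDerivAt (hwin φ) hn (fun x _ => hf x) (hf'.intervalIntegrable _ _), hper,
    sub_self, mul_zero, zero_sub]
  have hπ : (π : ℂ) ≠ 0 := by exact_mod_cast Real.pi_pos.ne'
  have hn' : (n : ℂ) ≠ 0 := by exact_mod_cast hn
  push_cast
  field_simp
  ring

/-- **The support gain**: if `‖f‖ ≤ B` and `f` vanishes on `(φ + 2πθ, φ + 2π)` (`0 < θ ≤ 1`) then
`‖f̂(n)‖ ≤ B θ` over the window `(φ, φ + 2π]`. [folklore] -/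
private theorem norm_fourierCoeffOn_window_le {f : ℝ → ℂ} {B θ : ℝ} (hB : 0 ≤ B) (hθ : 0 < θ)
    (hθ1 : θ ≤ 1) (hfB : ∀ x, ‖f x‖ ≤ B)
    (hzero : ∀ x, φ + 2 * π * θ < x → x < φ + 2 * π → f x = 0) (n : ℤ) :
    ‖fourierCoeffOn (hwin φ) f n‖ ≤ B * θ := by
  rw [fourierCoeffOn_eq_integral, norm_smul]
  set g : ℝ → ℝ := (Set.Ioc φ (φ + 2 * π * θ)).indicator fun _ => B with hg
  have hπ := Real.pi_pos
  have hsub : Set.Ioc φ (φ + 2 * π * θ) ⊆ Set.Ioc φ (φ + 2 * π) :=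
    Set.Ioc_subset_Ioc_right (by nlinarith)
  -- the integrand is bounded by the indicator, off the endpoint
  have hae : ∀ᵐ t : ℝ, t ≠ φ + 2 * π := by
    rw [ae_iff]
    simp
  have hbound : ∀ᵐ t : ℝ, t ∈ Set.Ioc φ (φ + 2 * π) →
      ‖(fourier (-n)) (t : AddCircle (φ + 2 * π - φ)) • f t‖ ≤ g t := by
    filter_upwards [hae] with t ht hmem
    rw [norm_smul, norm_fourier_apply', one_mul, hg]
    by_cases h : t ≤ φ + 2 * π * θ
    · rw [Set.indicator_of_mem (show t ∈ Set.Ioc φ (φ + 2 * π * θ) from ⟨hmem.1, h⟩)]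
      exact hfB t
    · rw [hzero t (not_le.mp h) (lt_of_le_of_ne hmem.2 ht), norm_zero]
      exact Set.indicator_nonneg (fun _ _ => hB) _
  have hgi : IntervalIntegrable g volume φ (φ + 2 * π) := by
    refine (intervalIntegrable_const (c := B)).mono_fun'
      (aestronglyMeasurable_const.indicator measurableSet_Ioc) (Filter.Eventually.of_forall fun t => ?_)
    dsimp only
    rw [hg, Real.norm_eq_abs, abs_of_nonneg (Set.indicator_nonneg (fun _ _ => hB) _)]
    exact Set.indicator_le_self' (fun _ _ => hB) t
  have hint := intervalIntegral.norm_integral_le_of_norm_le (hwin φ).le hbound hgi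
  -- `∫ g = B · 2πθ`
  have hgint : ∫ t in φ..(φ + 2 * π), g t = B * (2 * π * θ) := by
    rw [intervalIntegral.integral_of_le (hwin φ).le, hg, setIntegral_indicator measurableSet_Ioc,
      Set.inter_eq_self_of_subset_right hsub, setIntegral_const, Real.volume_real_Ioc_of_le (by nlinarith),
      smul_eq_mul]
    ring
  rw [hgint] at hint
  have hL : φ + 2 * π - φ = 2 * π := by ring
  simp only [hL] at hint ⊢
  rw [Real.norm_eq_abs, abs_of_pos (by positivity : (0 : ℝ) < 1 / (2 * π))]
  refine (mul_le_mul_of_nonneg_left hint (by positivity)).trans_eq ?_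
  field_simp

end Window

/-! ### Vanishing outside the arc -/

/-- A function supported on the arcs `(φ, φ + 2πθ] + 2πℤ` vanishes on `(φ + 2πθ, φ + 2π)`.
[folklore] -/
private theorem sector_eq_zero {q : ℝ → ℝ} {θ φ : ℝ}
    (hsupp : ∀ u, q u ≠ 0 → ∃ k : ℤ, φ < u - 2 * π * k ∧ u - 2 * π * k ≤ φ + 2 * π * θ)
    {x : ℝ} (h1 : φ + 2 * π * θ < x) (h2 : x < φ + 2 * π) : q x = 0 := by
  by_contra h
  obtain ⟨k, hk1, hk2⟩ := hsupp x h
  have hπ := Real.pi_pos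
  rcases lt_trichotomy k 0 with hk | rfl | hk
  · have hk' : (k : ℝ) ≤ -1 := by exact_mod_cast Int.le_sub_one_of_lt hk
    nlinarith [mul_nonneg hπ.le (show (0 : ℝ) ≤ -1 - k by linarith)]
  · simp only [Int.cast_zero, mul_zero, sub_zero] at hk1 hk2
    linarith
  · have hk' : (1 : ℝ) ≤ k := by exact_mod_cast hk
    nlinarith [mul_nonneg hπ.le (show (0 : ℝ) ≤ k - 1 by linarith)]

/-- A function vanishing on an open interval has vanishing derivative there. [folklore] -/
private theorem deriv_eq_zero_of_Ioo {f : ℝ → ℝ} {a b x : ℝ}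
    (hf : ∀ y, a < y → y < b → f y = 0) (h1 : a < x) (h2 : x < b) : deriv f x = 0 := by
  have h : f =ᶠ[𝓝 x] fun _ => (0 : ℝ) :=
    Filter.eventuallyEq_of_mem (Ioo_mem_nhds h1 h2) fun y hy => hf y hy.1 hy.2
  rw [h.deriv_eq, deriv_const]

/-! ### (16.26): the Fourier coefficients of the angle mollifier -/

/-- `min(θ, θ⁻¹ℓ⁻²) ≤ 2θ(1 + θ²ℓ²)⁻¹`: the two coefficient bounds of `hasSum_fourier_of_sector`
give the printed shape of (16.26). [cite: FriedlanderIwaniecAnnals1998, (16.26)] -/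
theorem le_sector_coeff_bound {θ x : ℝ} {k : ℤ} (hθ : 0 < θ) (h0 : x ≤ θ)
    (hk : k ≠ 0 → x ≤ θ⁻¹ / (k : ℝ) ^ 2) : x ≤ 2 * θ / (1 + θ ^ 2 * (k : ℝ) ^ 2) := by
  rw [le_div_iff₀ (by positivity)]
  rcases eq_or_ne k 0 with rfl | hk0
  · simp only [Int.cast_zero]
    nlinarith
  · have hk' : (k : ℝ) ≠ 0 := by exact_mod_cast hk0
    have hk2 : (0 : ℝ) < (k : ℝ) ^ 2 := by rw [← sq_abs]; exact pow_pos (abs_pos.mpr hk') 2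
    have h1 : x * (k : ℝ) ^ 2 ≤ θ⁻¹ := (le_div_iff₀ hk2).mp (hk hk0)
    have h2 : x * (k : ℝ) ^ 2 * θ ≤ 1 := by
      have := mul_le_mul_of_nonneg_right h1 hθ.le
      rwa [inv_mul_cancel₀ hθ.ne'] at this
    nlinarith [mul_le_mul_of_nonneg_right h2 hθ.le]

/-- **(16.26), the Fourier expansion of the angle mollifier.** Let `q : ℝ → ℝ` be `2π`-periodic and
`C²`, supported on the arcs `φ < α - 2πk ≤ φ + 2πθ` (`k ∈ ℤ`, `0 < θ ≤ 1`), with `|q| ≤ 1` and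
`|q''| ≤ θ⁻²` (the properties recorded before (5.13)). Then there are coefficients `q̂ : ℤ → ℂ` with
`|q̂(ℓ)| ≤ θ` for all `ℓ`, `|q̂(ℓ)| ≤ θ⁻¹ℓ⁻²` for `ℓ ≠ 0` (hence `|q̂(ℓ)| ≤ 2θ(1 + θ²ℓ²)⁻¹`,
`le_sector_coeff_bound`), `Σ_ℓ |q̂(ℓ)| < ∞`, and `q(α) = Σ_ℓ q̂(ℓ) e^{iℓα}` for every real `α`.
[cite: FriedlanderIwaniecAnnals1998, (16.26)] -/
theorem hasSum_fourier_of_sector {q : ℝ → ℝ} {θ φ : ℝ} (hθ : 0 < θ) (hθ1 : θ ≤ 1)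
    (hper : Function.Periodic q (2 * π)) (hq : ContDiff ℝ 2 q)
    (hsupp : ∀ u, q u ≠ 0 → ∃ k : ℤ, φ < u - 2 * π * k ∧ u - 2 * π * k ≤ φ + 2 * π * θ)
    (h0 : ∀ u, |q u| ≤ 1) (h2 : ∀ u, |deriv (deriv q) u| ≤ θ⁻¹ ^ 2) :
    ∃ c : ℤ → ℂ, (∀ k, ‖c k‖ ≤ θ) ∧ (∀ k : ℤ, k ≠ 0 → ‖c k‖ ≤ θ⁻¹ / (k : ℝ) ^ 2) ∧
      (Summable fun k => ‖c k‖) ∧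
      ∀ u : ℝ, HasSum (fun k : ℤ => c k * Complex.exp (k * u * I)) (q u) := by
  haveI : Fact (0 < 2 * π) := ⟨Real.two_pi_pos⟩
  -- the two derivatives
  set g₁ := deriv q with hg₁
  set g₂ := deriv g₁ with hg₂
  have hg₁c : ContDiff ℝ 1 g₁ := hq.deriv'
  have hg₂c : ContDiff ℝ 0 g₂ := hg₁c.deriv'
  have hd₀ : ∀ x, HasDerivAt q (g₁ x) x := fun x =>
    ((hq.differentiable (by norm_num)) x).hasDerivAt
  have hd₁ : ∀ x, HasDerivAt g₁ (g₂ x) x := fun x =>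
    ((hg₁c.differentiable (by norm_num)) x).hasDerivAt
  have hperD : ∀ {f : ℝ → ℝ}, Function.Periodic f (2 * π) →
      Function.Periodic (deriv f) (2 * π) := by
    intro f hf x
    have e : (fun y => f (y + 2 * π)) = f := funext hf
    rw [← deriv_comp_add_const, e]
  have hp₁ : Function.Periodic g₁ (2 * π) := hperD hper
  -- vanishing on `(φ + 2πθ, φ + 2π)`
  have hz₀ : ∀ x, φ + 2 * π * θ < x → x < φ + 2 * π → q x = 0 := fun x =>
    sector_eq_zero hsupp
  have hz₁ : ∀ x, φ + 2 * π * θ < x → x < φ + 2 * π → g₁ x = 0 := fun x hx₁ hx₂ =>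
    deriv_eq_zero_of_Ioo hz₀ hx₁ hx₂
  have hz₂ : ∀ x, φ + 2 * π * θ < x → x < φ + 2 * π → g₂ x = 0 := fun x hx₁ hx₂ =>
    deriv_eq_zero_of_Ioo hz₁ hx₁ hx₂
  -- complexifications
  set G : ℝ → ℂ := fun u => (q u : ℂ) with hG
  set G₁ : ℝ → ℂ := fun u => (g₁ u : ℂ)
  set G₂ : ℝ → ℂ := fun u => (g₂ u : ℂ)
  have hD₀ : ∀ x, HasDerivAt G (G₁ x) x := fun x => (hd₀ x).ofReal_comp
  have hD₁ : ∀ x, HasDerivAt G₁ (G₂ x) x := fun x => (hd₁ x).ofReal_comp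
  have hG₁cont : Continuous G₁ := continuous_ofReal.comp hg₁c.continuous
  have hG₂cont : Continuous G₂ := continuous_ofReal.comp hg₂c.continuous
  -- the lift to the circle (window `(φ, φ + 2π]`) and its Fourier coefficients
  set F : AddCircle (2 * π) → ℂ := AddCircle.liftIoc (2 * π) φ G with hF
  have hFc : Continuous F := by
    refine AddCircle.liftIoc_continuous ?_ (continuous_ofReal.comp hq.continuous).continuousOn
    change (q φ : ℂ) = (q (φ + 2 * π) : ℂ)
    rw [hper]
  set Fc : C(AddCircle (2 * π), ℂ) := ⟨F, hFc⟩
  set c : ℤ → ℂ := fourierCoeff (Fc : AddCircle (2 * π) → ℂ) with hc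
  have hcoeff : ∀ n, c n = fourierCoeffOn (hwin φ) G n := fun n => fourierCoeff_liftIoc_eq G n
  -- the bounds: support gain, and two integrations by parts followed by the support gain
  have hc0 : ∀ k, ‖c k‖ ≤ θ := by
    intro k
    rw [hcoeff]
    have h := norm_fourierCoeffOn_window_le (f := G) zero_le_one hθ hθ1
      (fun x => by change ‖(q x : ℂ)‖ ≤ 1; rw [Complex.norm_real, Real.norm_eq_abs]; exact h0 x)
      (fun x hx₁ hx₂ => by change (q x : ℂ) = 0; rw [hz₀ x hx₁ hx₂, Complex.ofReal_zero]) k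
    rwa [one_mul] at h
  have hck : ∀ k : ℤ, k ≠ 0 → ‖c k‖ ≤ θ⁻¹ / (k : ℝ) ^ 2 := by
    intro k hk
    rw [hcoeff, fourierCoeffOn_window_of_hasDerivAt hk hD₀ hG₁cont
        (by change (q _ : ℂ) = _; rw [hper]),
      fourierCoeffOn_window_of_hasDerivAt hk hD₁ hG₂cont (by change (g₁ _ : ℂ) = _; rw [hp₁])]
    have h2' : ‖fourierCoeffOn (hwin φ) G₂ k‖ ≤ θ⁻¹ ^ 2 * θ :=
      norm_fourierCoeffOn_window_le (f := G₂) (by positivity) hθ hθ1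
        (fun x => by
          change ‖(g₂ x : ℂ)‖ ≤ θ⁻¹ ^ 2; rw [Complex.norm_real, Real.norm_eq_abs]; exact h2 x)
        (fun x hx₁ hx₂ => by change (g₂ x : ℂ) = 0; rw [hz₂ x hx₁ hx₂, Complex.ofReal_zero]) k
    have hk' : (k : ℝ) ≠ 0 := by exact_mod_cast hk
    have hnI : ‖(1 : ℂ) / (I * k)‖ = 1 / |(k : ℝ)| := by
      rw [norm_div, norm_one, norm_mul, Complex.norm_I, one_mul, Complex.norm_intCast]
    rw [norm_mul, norm_mul, hnI]
    have hk0 : 0 < |(k : ℝ)| := abs_pos.mpr hk'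
    calc 1 / |(k : ℝ)| * (1 / |(k : ℝ)| * ‖fourierCoeffOn (hwin φ) G₂ k‖)
        = ‖fourierCoeffOn (hwin φ) G₂ k‖ / |(k : ℝ)| ^ 2 := by field_simp
      _ ≤ θ⁻¹ ^ 2 * θ / |(k : ℝ)| ^ 2 := div_le_div_of_nonneg_right h2' (by positivity)
      _ = θ⁻¹ / (k : ℝ) ^ 2 := by
          rw [sq_abs]
          congr 1
          rw [pow_two, mul_assoc, inv_mul_cancel₀ hθ.ne', mul_one]
  -- summability
  have hsum : Summable fun k => ‖c k‖ := by
    have hmaj : Summable fun k : ℤ =>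
        θ * (if k = 0 then (1 : ℝ) else 0) + θ⁻¹ * |1 / (k : ℝ) ^ 2| := by
      refine Summable.add ?_ ?_
      · refine (summable_of_ne_finset_zero (s := {0}) fun k hk => ?_).mul_left θ
        rw [Finset.mem_singleton] at hk; rw [if_neg hk]
      · exact ((Real.summable_one_div_int_pow.mpr (by norm_num : 1 < 2)).abs).mul_left θ⁻¹
    refine Summable.of_nonneg_of_le (fun k => norm_nonneg _) (fun k => ?_) hmaj
    by_cases hk : k = 0
    · subst hk; simp; exact hc0 0
    · rw [if_neg hk, mul_zero, zero_add]
      refine (hck k hk).trans (le_of_eq ?_)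
      rw [abs_of_nonneg (by positivity), ← div_eq_mul_one_div]
  refine ⟨c, hc0, hck, hsum, fun u => ?_⟩
  -- pointwise convergence on the circle
  have hsum' : Summable (fourierCoeff (Fc : AddCircle (2 * π) → ℂ)) := by
    rw [← hc]; exact hsum.of_norm
  have hpt := has_pointwise_sum_fourier_series_of_summable hsum' (u : AddCircle (2 * π))
  -- reduce `u` into the window `(φ, φ + 2π]` by periodicity
  have hvmem : toIocMod Real.two_pi_pos φ u ∈ Set.Ioc φ (φ + 2 * π) := toIocMod_mem_Ioc _ _ _
  have huv : toIocMod Real.two_pi_pos φ u + toIocDiv Real.two_pi_pos φ u • (2 * π) = u :=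
    toIocMod_add_toIocDiv_zsmul _ _ _
  have hcoe : ((u : ℝ) : AddCircle (2 * π)) =
      ((toIocMod Real.two_pi_pos φ u : ℝ) : AddCircle (2 * π)) := by
    conv_lhs => rw [← huv]
    rw [AddCircle.coe_add, AddCircle.coe_zsmul, AddCircle.coe_period, smul_zero, add_zero]
  have hFu : Fc (u : AddCircle (2 * π)) = (q u : ℂ) := by
    change F (u : AddCircle (2 * π)) = _
    rw [hF, hcoe, AddCircle.liftIoc_coe_apply hvmem]
    change (q (toIocMod Real.two_pi_pos φ u) : ℂ) = _
    conv_rhs => rw [← huv]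
    rw [hper.zsmul]
  rw [hFu] at hpt
  convert hpt using 2 with k
  rw [← hc, smul_eq_mul, fourier_coe_apply]
  congr 1
  have hπ : (π : ℂ) ≠ 0 := by exact_mod_cast Real.pi_pos.ne'
  push_cast
  field_simp

/-! ### (16.27): truncating the Fourier series -/

/-- The tail of `Σ ℓ⁻²`: `Σ_{i < N, i > L} i⁻² ≤ L⁻¹` (`L ≥ 1`). [folklore] -/
private theorem sum_range_tail_inv_sq_le {L : ℕ} (hL : L ≠ 0) (N : ℕ) :
    ∑ i ∈ Finset.range N, (if L < i then ((i : ℝ) ^ 2)⁻¹ else 0) ≤ (L : ℝ)⁻¹ := by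
  rw [← Finset.sum_filter]
  calc ∑ i ∈ (Finset.range N).filter (fun i => L < i), ((i : ℝ) ^ 2)⁻¹
      ≤ ∑ i ∈ Finset.Ioc L (L + N), ((i : ℝ) ^ 2)⁻¹ := by
        refine Finset.sum_le_sum_of_subset_of_nonneg (fun i hi => ?_) fun _ _ _ => by positivity
        simp only [Finset.mem_filter, Finset.mem_range] at hi
        simp only [Finset.mem_Ioc]
        omega
    _ ≤ (L : ℝ)⁻¹ - ((L + N : ℕ) : ℝ)⁻¹ := sum_Ioc_inv_sq_le_sub hL (Nat.le_add_right _ _)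
    _ ≤ (L : ℝ)⁻¹ := sub_le_self _ (by positivity)

/-- **(16.27), the truncation.** If `|c(ℓ)| ≤ θ⁻¹ℓ⁻²` for `ℓ ≠ 0` and `Σ_ℓ c(ℓ) e^{iℓα} = a`, then
`|a - Σ_{|ℓ| ≤ L} c(ℓ) e^{iℓα}| ≤ 2θ⁻¹L⁻¹` for `L ≥ 1` — the printed `O(θ⁻¹L⁻¹)` with the
constant `2`. [cite: FriedlanderIwaniecAnnals1998, (16.27)] -/
theorem norm_sub_sum_Icc_le_of_coeff_bound {c : ℤ → ℂ} {θ : ℝ} (hθ : 0 < θ)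
    (hck : ∀ k : ℤ, k ≠ 0 → ‖c k‖ ≤ θ⁻¹ / (k : ℝ) ^ 2) {α : ℝ} {a : ℂ}
    (ha : HasSum (fun k : ℤ => c k * Complex.exp (k * α * I)) a) {L : ℕ} (hL : 1 ≤ L) :
    ‖a - ∑ k ∈ Finset.Icc (-(L : ℤ)) L, c k * Complex.exp (k * α * I)‖ ≤ 2 * θ⁻¹ / L := by
  set S : Finset ℤ := Finset.Icc (-(L : ℤ)) L with hS
  set f : ℤ → ℂ := fun k => c k * Complex.exp (k * α * I) with hf
  have hL0 : L ≠ 0 := by omega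
  have h0S : ∀ k : ℤ, k ∉ S → k ≠ 0 := by
    rintro k hk rfl
    exact hk (by simp [hS])
  have hnf : ∀ k, ‖f k‖ = ‖c k‖ := by
    intro k
    have he : Complex.exp (k * α * I) = Complex.exp (((k : ℝ) * α : ℝ) * I) := by push_cast; rfl
    simp only [hf, norm_mul, he, Complex.norm_exp_ofReal_mul_I, mul_one]
  -- the tail series `g = f · 1_{ℤ ∖ S}` sums to `a - Σ_S f`
  set g : ℤ → ℂ := fun k => if k ∈ S then 0 else f k with hg
  have hgsum : HasSum g (a - ∑ k ∈ S, f k) := by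
    have h1 : HasSum (fun k => if k ∈ S then f k else 0) (∑ k ∈ S, f k) := by
      have h : HasSum (fun k => if k ∈ S then f k else 0) (∑ k ∈ S, if k ∈ S then f k else 0) :=
        hasSum_sum_of_ne_finset_zero fun k hk => if_neg hk
      have hs : ∑ k ∈ S, (if k ∈ S then f k else 0) = ∑ k ∈ S, f k :=
        Finset.sum_congr rfl fun k hk => if_pos hk
      rwa [hs] at h
    have hfg : g = fun k => f k - (if k ∈ S then f k else 0) := by
      funext k
      simp only [hg]
      split_ifs <;> simp
    rw [hfg]
    exact ha.sub h1
  -- the majorant `b = θ⁻¹ℓ⁻² · 1_{ℤ ∖ S}`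
  set b : ℤ → ℝ := fun k => if k ∈ S then 0 else θ⁻¹ / (k : ℝ) ^ 2 with hb
  have hb0 : ∀ k, 0 ≤ b k := fun k => by
    simp only [hb]
    split_ifs <;> positivity
  have hgb : ∀ k, ‖g k‖ ≤ b k := by
    intro k
    simp only [hg, hb]
    split_ifs with hk
    · simp
    · rw [hnf]; exact hck k (h0S k hk)
  have hbs : Summable b := by
    refine Summable.of_nonneg_of_le hb0 (fun k => ?_)
      (((Real.summable_one_div_int_pow.mpr (by norm_num : 1 < 2)).abs).mul_left θ⁻¹)
    simp only [hb]
    split_ifs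
    · positivity
    · rw [abs_of_nonneg (by positivity), ← div_eq_mul_one_div]
  have hgs : Summable fun k => ‖g k‖ := Summable.of_nonneg_of_le (fun _ => norm_nonneg _) hgb hbs
  rw [← hgsum.tsum_eq]
  refine (norm_tsum_le_tsum_norm hgs).trans ((hgs.tsum_le_tsum hgb hbs).trans ?_)
  -- `Σ_ℤ b = Σ_{ℓ ≥ 0} b(ℓ) + Σ_{ℓ ≥ 0} b(-ℓ-1) ≤ θ⁻¹/L + θ⁻¹/L`
  have hinj : Function.Injective fun n : ℕ => -((n : ℤ) + 1) := by
    intro m n h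
    simpa using h
  rw [tsum_of_nat_of_neg_add_one (hbs.comp_injective Nat.cast_injective) (hbs.comp_injective hinj)]
  have hpos : ∑' n : ℕ, b n ≤ θ⁻¹ / L := by
    refine Real.tsum_le_of_sum_range_le (fun n => hb0 n) fun N => ?_
    have he : ∀ i : ℕ, b i = θ⁻¹ * (if L < i then ((i : ℝ) ^ 2)⁻¹ else 0) := by
      intro i
      simp only [hb, hS, Finset.mem_Icc, Int.cast_natCast]
      split_ifs <;> first | (exfalso; omega) | ring
    rw [Finset.sum_congr rfl fun i _ => he i, ← Finset.mul_sum, div_eq_mul_inv]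
    exact mul_le_mul_of_nonneg_left (sum_range_tail_inv_sq_le hL0 N) (by positivity)
  have hneg : ∑' n : ℕ, b (-((n : ℤ) + 1)) ≤ θ⁻¹ / L := by
    refine Real.tsum_le_of_sum_range_le (fun n => hb0 _) fun N => ?_
    have he : ∀ i : ℕ, b (-((i : ℤ) + 1)) =
        θ⁻¹ * (if L < i + 1 then (((i + 1 : ℕ) : ℝ) ^ 2)⁻¹ else 0) := by
      intro i
      simp only [hb, hS, Finset.mem_Icc, Int.cast_neg, Int.cast_add, Int.cast_natCast,
        Int.cast_one, neg_sq, Nat.cast_add, Nat.cast_one]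
      split_ifs <;> first | (exfalso; omega) | ring
    rw [Finset.sum_congr rfl fun i _ => he i, ← Finset.mul_sum, div_eq_mul_inv]
    refine mul_le_mul_of_nonneg_left ?_ (by positivity)
    have hA := sum_range_tail_inv_sq_le hL0 (N + 1)
    rw [Finset.sum_range_succ'] at hA
    simpa using hA
  have h2L : (2 : ℝ) * θ⁻¹ / L = θ⁻¹ / L + θ⁻¹ / L := by ring
  rw [h2L]
  exact add_le_add hpos hneg

/-- **(16.26)–(16.27) for a sector cutoff `q`**: the Fourier expansion with
`|q̂(ℓ)| ≤ 2θ(1 + θ²ℓ²)⁻¹` and the truncation `|q(α) - Σ_{|ℓ| ≤ L} q̂(ℓ) e^{iℓα}| ≤ 2θ⁻¹L⁻¹`.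
[cite: FriedlanderIwaniecAnnals1998, (16.26)–(16.27)] -/
theorem fourier_truncation_of_sector {q : ℝ → ℝ} {θ φ : ℝ} (hθ : 0 < θ) (hθ1 : θ ≤ 1)
    (hper : Function.Periodic q (2 * π)) (hq : ContDiff ℝ 2 q)
    (hsupp : ∀ u, q u ≠ 0 → ∃ k : ℤ, φ < u - 2 * π * k ∧ u - 2 * π * k ≤ φ + 2 * π * θ)
    (h0 : ∀ u, |q u| ≤ 1) (h2 : ∀ u, |deriv (deriv q) u| ≤ θ⁻¹ ^ 2) :
    ∃ c : ℤ → ℂ, (∀ ℓ, ‖c ℓ‖ ≤ 2 * θ / (1 + θ ^ 2 * (ℓ : ℝ) ^ 2)) ∧ (Summable fun ℓ => ‖c ℓ‖) ∧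
      (∀ α : ℝ, HasSum (fun ℓ : ℤ => c ℓ * Complex.exp (ℓ * α * I)) (q α)) ∧
      ∀ L : ℕ, 1 ≤ L → ∀ α : ℝ,
        ‖(q α : ℂ) - ∑ ℓ ∈ Finset.Icc (-(L : ℤ)) L, c ℓ * Complex.exp (ℓ * α * I)‖ ≤
          2 * θ⁻¹ / L := by
  obtain ⟨c, hc0, hck, hsum, hpt⟩ := hasSum_fourier_of_sector hθ hθ1 hper hq hsupp h0 h2
  exact ⟨c, fun ℓ => le_sector_coeff_bound hθ (hc0 ℓ) (hck ℓ), hsum, hpt,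
    fun L hL α => norm_sub_sum_Icc_le_of_coeff_bound hθ hck (hpt α) hL⟩

/-- **(16.26)–(16.27) for the angle mollifier of (5.12)/(5.13)** (`FISectorCutoff ϑ θ φ q` of
`FriedlanderIwaniecPrimesDispersion`, `0 < θ ≤ 1`): `q(α) = Σ_ℓ q̂(ℓ) e^{iℓα}` with
`|q̂(ℓ)| ≤ 2θ(1 + θ²ℓ²)⁻¹`, and `|q(α) - Σ_{|ℓ| ≤ L} q̂(ℓ) e^{iℓα}| ≤ 2θ⁻¹L⁻¹` (`L ≥ 1`).
[cite: FriedlanderIwaniecAnnals1998, (16.26)–(16.27)] -/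
theorem FISectorCutoff.fourier_truncation {ϑ θ φ : ℝ} {q : ℝ → ℝ} (h : FISectorCutoff ϑ θ φ q)
    (hθ : 0 < θ) (hθ1 : θ ≤ 1) :
    ∃ c : ℤ → ℂ, (∀ ℓ, ‖c ℓ‖ ≤ 2 * θ / (1 + θ ^ 2 * (ℓ : ℝ) ^ 2)) ∧ (Summable fun ℓ => ‖c ℓ‖) ∧
      (∀ α : ℝ, HasSum (fun ℓ : ℤ => c ℓ * Complex.exp (ℓ * α * I)) (q α)) ∧
      ∀ L : ℕ, 1 ≤ L → ∀ α : ℝ,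
        ‖(q α : ℂ) - ∑ ℓ ∈ Finset.Icc (-(L : ℤ)) L, c ℓ * Complex.exp (ℓ * α * I)‖ ≤
          2 * θ⁻¹ / L :=
  fourier_truncation_of_sector hθ hθ1 h.periodic h.smooth h.supp h.bound h.deriv2_bound

end Literature.NumberTheory.Sieve.FriedlanderIwaniecPrimes
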